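import Literature.Barriers.CriticalPhenomena.PositionSpaceRGNonGibbsianEq413SpacingReduction
import Literature.Barriers.CriticalPhenomena.PositionSpaceRGNonGibbsianPeierlsCondition
import Literature.Probability.LatticeModels.ZdBoxesLines
import Literature.Probability.LatticeModels.IsingConfigSums
import Literature.Probability.LatticeModels.PSPolymerActivity
import HarnessLib

/-!
# Barrier `PositionSpaceRGNonGibbsian`, Theorem 4.3 (decimation, spacing `b ≥ 3`): thick contours
# for the internal-spin system with alternating image spins — geometry

Companion file on the Theorem 4.3 line of
`Literature/Barriers/CriticalPhenomena/PositionSpaceRGNonGibbsian.lean` (van Enter–Fernández–Sokal,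
J. Stat. Phys. **72** (1993) 879, arXiv:hep-lat/9210032). What is left of the finite-volume
estimate `VEFS1993_eq413_spacing` is the low-temperature `+` phase of the internal-spin system with
fully alternating image spins for `b ≥ 3` (`…Eq413SpacingReduction.lean`,
`VEFS1993_eq413_spacing_of_plusPhase_three_le`), which the source obtains from Pirogov–Sinai
theory (§4.3.2 and App. B.5.3: "these ground states satisfy the Peierls condition. It follows
from P–S theory that at low temperature there are precisely two periodic Gibbs measures"). The two
ground states `ω^{(+)}` (internal spins `+`) and `ω^{(-)}` are exchanged by the symmetry
`T = (spin flip) ∘ (translation by b e₁)` of the infinite alternating system, and this symmetry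
allows a direct Peierls argument with THICK contours (Friedli–Velenik 2017, §7.2: `d_∞`-balls of
radius `r`, `★`-connected supports, exterior/interior components, labels): erase an external
contour and transport its `-` interior components by `T`; the energy balance is controlled by the
Peierls condition of `…PeierlsCondition.lean`. This file sets up the contour geometry for a spin
configuration `σ` of the finite-volume system `⟨W(R'); ξ_p⟩` of `VEFS1993_plusPhase`
(`W(R') = spacingVolume d b R'`, `ξ_p = signedCoreAnnulusBC d b p R' R' 1 1`; the origin is a free
"spin site" sitting at an image position):

* spin sites / genuine image sites (`IsSpin`, `IsGImg`), the values of `ξ_p`;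
* **bad sites** (`IsBad`: the spin sites of the `r`-ball about `y` are not all equal), the sign
  `bsign` of a good site, and the key lattice lemma `exists_frustrated_adj`: in a ball containing
  spin sites of both signs there is a frustrated nearest-neighbour pair of spin sites (a monotone
  path with detours around the isolated image sites);
* propagation of signs between `★`-adjacent good sites, goodness far away;
* **contours** = `★`-components of the bad set; every site carrying a `-` spin lies in the hull of
  an EXTERNAL contour (one whose exterior boundary is `+`): `exists_plusExterior_contour`
  (via Friedli–Velenik Lemma 7.19 / `StarComponents`);
* interior components, their labels, and the **rim lemma**: inside a `-` component, every site
  within sup-distance `r` of the complement carries `-`, and `-` components stay `r` inside the box.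

Everything is proved; no named facts (D-0014, D-0026).

## References

* A. C. D. van Enter, R. Fernández, A. D. Sokal, J. Stat. Phys. 72 (1993) 879–1167,
  arXiv:hep-lat/9210032 — §4.3.1 Step 2, §4.3.2, App. B.5.3 [VanenterFernandezSokal1993].
* S. Friedli, Y. Velenik, *Statistical Mechanics of Lattice Systems*, CUP 2017, §7.2
  (thick contours, Lemma 7.19), §3.7.2 (Peierls argument) [FriedliVelenik2017].
-/

noncomputable section

namespace Literature.Barriers.CriticalPhenomena.NonGibbs

open Finset Relation Literature.Probability.LatticeModels

namespace SpacingPeierls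

variable {d : ℕ}

/-! ### Spin sites and genuine image sites -/

section Sites

variable (b : ℕ)

/-- **Spin sites**: the internal sites together with the origin (whose spin is free in `W(R')`).
[cite: VanenterFernandezSokal1993, §4.1.2 Step 3 and §4.2 Step 2] -/
def IsSpin (y : Site d) : Prop := ¬ IsSpImageSite d b y ∨ y = 0

/-- **Genuine image sites**: image sites other than the origin (their spins are frozen to `ξ`).
[cite: VanenterFernandezSokal1993, §3.1.2 eq. (3.7)] -/
def IsGImg (y : Site d) : Prop := IsSpImageSite d b y ∧ y ≠ 0

/-- Being a spin site is decidable. [folklore] -/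
instance (y : Site d) : Decidable (IsSpin (d := d) b y) :=
  inferInstanceAs (Decidable (¬ IsSpImageSite d b y ∨ y = 0))

/-- Being a genuine image site is decidable. [folklore] -/
instance (y : Site d) : Decidable (IsGImg (d := d) b y) :=
  inferInstanceAs (Decidable (IsSpImageSite d b y ∧ y ≠ 0))

variable {b}

/-- A site is a spin site iff it is not a genuine image site. [folklore] -/
theorem isSpin_iff_not_isGImg {y : Site d} : IsSpin b y ↔ ¬ IsGImg b y := by
  unfold IsSpin IsGImg; tauto

/-- The origin is a spin site. [cite: VanenterFernandezSokal1993, §4.1.2 Step 3] -/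
theorem isSpin_zero : IsSpin b (0 : Site d) := Or.inr rfl

/-- Internal sites are spin sites. [cite: VanenterFernandezSokal1993, §4.2 Step 2] -/
theorem isSpin_of_not_isSpImageSite {y : Site d} (hy : ¬ IsSpImageSite d b y) : IsSpin b y := Or.inl hy

/-- A spin site other than the origin is internal. [folklore] -/
theorem not_isSpImageSite_of_isSpin {y : Site d} (hy : IsSpin b y) (hy0 : y ≠ 0) : ¬ IsSpImageSite d b y :=
  hy.resolve_right hy0

/-- A neighbour of an image site is a spin site (`b ≥ 2`). [cite: VanenterFernandezSokal1993, §4.1.2 Step 1] -/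
theorem isSpin_of_adj_isSpImageSite (hb : 2 ≤ b) {a y : Site d} (ha : IsSpImageSite d b a) (h : (zdGraph d).Adj a y) :
    IsSpin b y :=
  isSpin_of_not_isSpImageSite (not_isSpImageSite_of_adj hb ha h)

/-- A neighbour of a genuine image site is a spin site (`b ≥ 2`). [cite: VanenterFernandezSokal1993, §4.1.2 Step 1] -/
theorem isSpin_of_adj_isGImg (hb : 2 ≤ b) {a y : Site d} (ha : IsGImg b a) (h : (zdGraph d).Adj a y) : IsSpin b y :=
  isSpin_of_adj_isSpImageSite hb ha.1 h

/-- Two adjacent sites are not both genuine images (`b ≥ 2`). [cite: VanenterFernandezSokal1993, §4.1.2 Step 1] -/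
theorem isSpin_or_isSpin_of_adj (hb : 2 ≤ b) {x y : Site d} (h : (zdGraph d).Adj x y) : IsSpin b x ∨ IsSpin b y := by
  by_cases hx : IsGImg b x
  · exact Or.inr (isSpin_of_adj_isGImg hb hx h)
  · exact Or.inl (isSpin_iff_not_isGImg.2 hx)

/-- `x + s eᵢ + t eⱼ` is not an image site when `a` is and `s = ±1`, `i ≠ j` or `t` arbitrary with
`i ≠ j`: a vector with a coordinate `±1` is not in `bℤ^d` (`b ≥ 2`). [folklore] -/
theorem not_isSpImageSite_add_of_apply_eq {a w : Site d} (hb : 2 ≤ b) (ha : IsSpImageSite d b a) (i : Fin d)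
    (hi : w i = a i + 1 ∨ w i = a i - 1) : ¬ IsSpImageSite d b w := by
  intro hw
  have h1 := ha i
  have h2 := hw i
  have : (b : ℤ) ∣ w i - a i := dvd_sub h2 h1
  rcases hi with h | h <;> rw [h] at this
  · rw [add_sub_cancel_left] at this
    have := Int.le_of_dvd one_pos this; omega
  · rw [show a i - 1 - a i = -1 by ring, Int.dvd_neg] at this
    have := Int.le_of_dvd one_pos this; omega

/-- Image sites are invariant under translation by `b eᵢ`. [cite: VanenterFernandezSokal1993, §4.3.2 (periodicity)] -/
theorem isSpImageSite_sub_bvec_iff (i : Fin d) {y : Site d} :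
    IsSpImageSite d b (y - (b : ℤ) • uvec i) ↔ IsSpImageSite d b y := by
  have := isSpImageSite_add_smul (d := d) (b := b) (y - (b : ℤ) • uvec i) (uvec i)
  rw [sub_add_cancel] at this
  exact this.symm

/-- Image sites are invariant under translation by `b eᵢ`. [cite: VanenterFernandezSokal1993, §4.3.2 (periodicity)] -/
theorem isSpImageSite_add_bvec_iff (i : Fin d) {y : Site d} :
    IsSpImageSite d b (y + (b : ℤ) • uvec i) ↔ IsSpImageSite d b y :=
  isSpImageSite_add_smul y (uvec i)

/-- `b eᵢ ≠ 0` for `b ≥ 1`. [folklore] -/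
theorem bvec_ne_zero (hb : 1 ≤ b) (i : Fin d) : ((b : ℤ) • uvec i : Site d) ≠ 0 := by
  intro h
  have := congrFun h i
  simp [uvec] at this
  omega

end Sites

/-! ### The boundary condition `ξ_p` and the volume `W(R')` -/

section BC

variable {b : ℕ} {p : ℤˣ} {R' : ℕ}

variable (d) in
/-- The boundary condition of `VEFS1993_plusPhase`: all image spins of `Λ_{R'}` alternating with
parity `p`, `+1` elsewhere. [cite: VanenterFernandezSokal1993, §4.3.1 Step 2 and §4.3.2] -/
abbrev ξb (b : ℕ) (p : ℤˣ) (R' : ℕ) : SpinConfig (Site d) := signedCoreAnnulusBC d b p R' R' 1 1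

/-- `ξ_p = +1` at internal sites. [cite: VanenterFernandezSokal1993, §4.3.1 Step 2] -/
theorem ξb_of_not_isSpImageSite {y : Site d} (hy : ¬ IsSpImageSite d b y) : ξb d b p R' y = 1 :=
  signedCoreAnnulusBC_apply_internal p R' R' 1 1 hy

/-- `ξ_p` at an image site `b x`: `p ω'_alt(x)` inside `Λ_{R'}`, `+1` outside. [cite: VanenterFernandezSokal1993, §4.3.1 Step 2] -/
theorem ξb_image (hb : 0 < b) (x : Site d) :
    ξb d b p R' (fun i => (b : ℤ) * x i) = if x ∈ box d R' then p * altConfig d x else 1 := by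
  rw [ξb, signedCoreAnnulusBC_apply_image hb]
  split_ifs <;> rfl

/-- `ξ_p(0) = p` (`ω'_alt(0) = +1`): the natural value at the origin. [cite: VanenterFernandezSokal1993, eq. (4.2)] -/
theorem ξb_zero (hb : 0 < b) : ξb d b p R' 0 = p := by
  have h := ξb_image (d := d) (p := p) (R' := R') hb 0
  have h0 : (fun i => (b : ℤ) * (0 : Site d) i) = 0 := funext fun i => by simp
  rw [h0] at h
  rw [h, if_pos (zero_mem_box d R'), altConfig_zero, mul_one]

/-- **`T`-covariance of the image spins**: for an image site `a` with `a` and `a - b e₁` image sites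
of `Λ_{R'}`, `ξ_p(a - b eᵢ) = -ξ_p(a)` (adjacent image sites of `ω'_alt` carry opposite spins).
[cite: VanenterFernandezSokal1993, eq. (4.2) and §4.3.2] -/
theorem ξb_sub_bvec (hb : 0 < b) (i : Fin d) {x : Site d} (hx : x ∈ box d R') (hx' : x - uvec i ∈ box d R') :
    ξb d b p R' (fun j => (b : ℤ) * (x - uvec i) j) = -ξb d b p R' (fun j => (b : ℤ) * x j) := by
  rw [ξb_image hb, ξb_image hb, if_pos hx, if_pos hx']
  have : x - uvec i = x + (-1 : ℤ) • (Pi.single i (1 : ℤ) : Site d) := by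
    rw [neg_one_smul, sub_eq_add_neg]
  rw [this, altConfig_add_zsmul_single x i (Or.inr rfl)]
  exact mul_neg p (altConfig d x)

/-- An image site is `b` times its quotient, and translating by `b eᵢ` shifts the quotient by `eᵢ`.
[cite: VanenterFernandezSokal1993, §3.1.2 eq. (3.7)] -/
theorem image_sub_bvec_eq {a : Site d} (ha : IsSpImageSite d b a) (i : Fin d) :
    a - (b : ℤ) • uvec i = fun j => (b : ℤ) * ((fun j => a j / b) - uvec i) j := by
  funext j
  simp only [Pi.sub_apply, Pi.smul_apply, smul_eq_mul, uvec_apply, mul_sub, Int.mul_ediv_cancel' (ha j), mul_ite,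
    mul_one, mul_zero]

/-- **`T`-covariance at genuine image sites**, coordinate-free form: if `a` is an image site with
quotient in `Λ_{R'}` and `a - b eᵢ` also has quotient in `Λ_{R'}`, then `ξ_p(a - b eᵢ) = -ξ_p(a)`.
[cite: VanenterFernandezSokal1993, eq. (4.2) and §4.3.2] -/
theorem ξb_sub_bvec' (hb : 0 < b) (i : Fin d) {a : Site d} (ha : IsSpImageSite d b a)
    (hx : (fun j => a j / b) ∈ box d R') (hx' : (fun j => a j / b) - uvec i ∈ box d R') :
    ξb d b p R' (a - (b : ℤ) • uvec i) = -ξb d b p R' a := by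
  rw [image_sub_bvec_eq ha i, ξb_sub_bvec hb i hx hx']
  congr 2
  exact (eq_mul_ediv_of_isSpImageSite ha).symm

/-- A spin site outside `W(R')` lies outside `Λ_{R'} = box d (bR')`. [cite: VanenterFernandezSokal1993, §4.2 Step 2] -/
theorem not_mem_box_of_isSpin_of_not_mem {y : Site d} (hy : IsSpin b y) (hyW : y ∉ spacingVolume d b R') :
    y ∉ box d (b * R') := by
  intro hbox
  apply hyW
  rw [spacingVolume, mem_filter]
  refine ⟨hbox, ?_⟩
  rcases hy with h | h
  · exact Or.inr h
  · exact Or.inl h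

/-- A spin site of `Λ_{R'}` lies in `W(R')`. [cite: VanenterFernandezSokal1993, §4.2 Step 2] -/
theorem mem_spacingVolume_of_isSpin {y : Site d} (hy : IsSpin b y) (hbox : y ∈ box d (b * R')) :
    y ∈ spacingVolume d b R' := by
  by_contra h
  exact not_mem_box_of_isSpin_of_not_mem hy h hbox

/-- Sites of `W(R')` are spin sites. [cite: VanenterFernandezSokal1993, §4.2 Step 2] -/
theorem isSpin_of_mem_spacingVolume {y : Site d} (hy : y ∈ spacingVolume d b R') : IsSpin b y := by
  rw [spacingVolume, mem_filter] at hy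
  rcases hy.2 with h | h
  · exact Or.inr h
  · exact Or.inl h

/-- Sites of `W(R')` lie in `Λ_{R'}`. [cite: VanenterFernandezSokal1993, §4.2 Step 2] -/
theorem mem_box_of_mem_spacingVolume {y : Site d} (hy : y ∈ spacingVolume d b R') : y ∈ box d (b * R') :=
  (mem_filter.1 hy).1

/-- `ξ_p = +1` at every spin site outside `W(R')` (the `+` exterior). [cite: VanenterFernandezSokal1993, §4.3.1 Step 2] -/
theorem ξb_of_isSpin_of_not_mem {y : Site d} (hy : IsSpin b y) (hyW : y ∉ spacingVolume d b R') :
    ξb d b p R' y = 1 := by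
  rcases hy with h | h
  · exact ξb_of_not_isSpImageSite h
  · exact absurd (zero_mem_spacingVolume b R') (h ▸ hyW)

/-- **Configurations of the system**: `σ` agrees with `ξ_p` off `W(R')`. [cite: VanenterFernandezSokal1993, §4.2 Step 2] -/
def IsCfg (b : ℕ) (p : ℤˣ) (R' : ℕ) (σ : SpinConfig (Site d)) : Prop := ∀ y, y ∉ spacingVolume d b R' → σ y = ξb d b p R' y

/-- Glued configurations are configurations of the system. [cite: FriedliVelenik2017, §3.1] -/
theorem isCfg_glue (τ : spacingVolume d b R' → ℤˣ) : IsCfg b p R' (glue (spacingVolume d b R') τ (.fixed (ξb d b p R'))) :=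
  fun y hy => by rw [glue_apply_of_notMem _ _ _ hy]; rfl

/-- In a configuration of the system every spin site outside `Λ_{R'}` carries `+1`.
[cite: VanenterFernandezSokal1993, §4.3.1 Step 2] -/
theorem IsCfg.apply_eq_one_of_not_mem_box {σ : SpinConfig (Site d)} (hσ : IsCfg b p R' σ) {y : Site d}
    (hy : IsSpin b y) (hbox : y ∉ box d (b * R')) : σ y = 1 := by
  have hyW : y ∉ spacingVolume d b R' := fun h => hbox (mem_box_of_mem_spacingVolume h)
  rw [hσ y hyW, ξb_of_isSpin_of_not_mem hy hyW]

/-- In a configuration of the system a spin site carrying `-1` lies in `W(R')` (and in `Λ_{R'}`).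
[cite: VanenterFernandezSokal1993, §4.3.1 Step 2] -/
theorem IsCfg.mem_of_apply_eq_neg_one {σ : SpinConfig (Site d)} (hσ : IsCfg b p R' σ) {y : Site d}
    (hy : IsSpin b y) (hneg : σ y = -1) : y ∈ spacingVolume d b R' := by
  by_contra hyW
  rw [hσ y hyW, ξb_of_isSpin_of_not_mem hy hyW] at hneg
  exact absurd hneg (by decide)

end BC

/-! ### Bad sites and the sign of a good site -/

section Bad

variable (b r : ℕ)

/-- **Bad sites** of a configuration (thick contours of radius `r`): `y` is bad when the spin sites
of the sup-ball of radius `r` about `y` do not all carry the same spin (the configuration is neither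
`ω^{(+)}`- nor `ω^{(-)}`-correct at `y`; Friedli–Velenik §7.2.1 with `d_∞`-balls).
[cite: FriedliVelenik2017, §7.2.1 (correct/incorrect points)] -/
def IsBad (σ : SpinConfig (Site d)) (y : Site d) : Prop :=
  ∃ z ∈ supBall r y, ∃ z' ∈ supBall r y, IsSpin b z ∧ IsSpin b z' ∧ σ z ≠ σ z'

/-- **The sign of a site**: `-1` if some spin site of its `r`-ball carries `-1`, else `+1`; at a
good site this is the common value of all spin sites of the ball. [cite: FriedliVelenik2017, §7.2.1] -/
def bsign (σ : SpinConfig (Site d)) (y : Site d) : ℤˣ :=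
  open Classical in if ∃ z ∈ supBall r y, IsSpin b z ∧ σ z = -1 then -1 else 1

variable {b r}

/-- **At a good site all spin sites of the ball carry the sign.** [cite: FriedliVelenik2017, §7.2.1] -/
theorem apply_eq_bsign {σ : SpinConfig (Site d)} {y : Site d} (hy : ¬ IsBad b r σ y) {z : Site d}
    (hz : z ∈ supBall r y) (hzs : IsSpin b z) : σ z = bsign b r σ y := by
  classical
  unfold bsign
  split_ifs with h
  · obtain ⟨z', hz', hz's, hneg⟩ := h
    by_contra hne
    exact hy ⟨z, hz, z', hz', hzs, hz's, by rw [hneg]; exact hne⟩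
  · push Not at h
    rcases Int.units_eq_one_or (σ z) with h1 | h1
    · exact h1
    · exact absurd h1 (h z hz hzs)

/-- A good site whose ball contains a spin site carrying `s` has sign `s`. [cite: FriedliVelenik2017, §7.2.1] -/
theorem bsign_eq_of_apply {σ : SpinConfig (Site d)} {y : Site d} (hy : ¬ IsBad b r σ y) {z : Site d}
    (hz : z ∈ supBall r y) (hzs : IsSpin b z) : bsign b r σ y = σ z :=
  (apply_eq_bsign hy hz hzs).symm

/-- The sign is `1` or `-1`. [folklore] -/
theorem bsign_eq_or (σ : SpinConfig (Site d)) (y : Site d) : bsign b r σ y = 1 ∨ bsign b r σ y = -1 := by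
  classical
  unfold bsign; split_ifs <;> simp

/-- A point of the coordinate box of two points of a sup-ball lies in the ball. [folklore] -/
theorem mem_supBall_of_mem_cbox {y z z' w : Site d} (hz : z ∈ supBall r y) (hz' : z' ∈ supBall r y)
    (hw : w ∈ cbox z z') : w ∈ supBall r y := by
  rw [mem_supBall] at hz hz' ⊢
  refine supDist_le_iff.2 fun i => ?_
  have h1 := (supDist_le_iff.1 hz) i
  have h2 := (supDist_le_iff.1 hz') i
  obtain ⟨h3, h4⟩ := hw i
  omega

/-- Membership in a sup-ball, coordinatewise. [folklore] -/
theorem mem_supBall_iff_forall {y w : Site d} : w ∈ supBall r y ↔ ∀ i, y i - r ≤ w i ∧ w i ≤ y i + r := by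
  rw [mem_supBall, supDist_le_iff]
  refine forall_congr' fun i => ?_
  omega

/-- **The frustrated-step lemma.** If a sup-ball of radius `r ≥ 1` contains a spin site carrying `-1`
and a spin site carrying `+1`, then it contains two ADJACENT spin sites carrying `-1` and `+1`
(`d ≥ 2`, `b ≥ 2`): follow a monotone lattice path and walk around the isolated image sites met on
the way, inside the ball. [cite: FriedliVelenik2017, §7.2.1; VanenterFernandezSokal1993, §4.1.2 Step 1 (isolated image spins)] -/
theorem exists_frustrated_adj (hd : 2 ≤ d) (hb : 2 ≤ b) (hr : 1 ≤ r) {σ : SpinConfig (Site d)} {y z z' : Site d}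
    (hz : z ∈ supBall r y) (hz' : z' ∈ supBall r y) (hzs : IsSpin b z) (hz's : IsSpin b z')
    (hσz : σ z = -1) (hσz' : σ z' = 1) :
    ∃ v ∈ supBall r y, ∃ v' ∈ supBall r y, IsSpin b v ∧ IsSpin b v' ∧ (zdGraph d).Adj v v' ∧ σ v = -1 ∧ σ v' = 1 := by
  -- strong induction on the `ℓ¹`-distance from `z` to `z'`
  suffices key : ∀ (n : ℕ) (z : Site d), z ∈ supBall r y → IsSpin b z → σ z = -1 → latL1Dist z z' ≤ n →
      ∃ v ∈ supBall r y, ∃ v' ∈ supBall r y, IsSpin b v ∧ IsSpin b v' ∧ (zdGraph d).Adj v v' ∧ σ v = -1 ∧ σ v' = 1 from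
    key _ z hz hzs hσz le_rfl
  intro n
  induction n using Nat.strong_induction_on with
  | _ n ih =>
  intro z hz hzs hσz hn
  have hne : z ≠ z' := fun h => by rw [h, hσz'] at hσz; exact absurd hσz (by decide)
  obtain ⟨z₁, hadj₁, hbox₁, hlt₁⟩ := exists_step_towards hne
  have hz₁B : z₁ ∈ supBall r y := mem_supBall_of_mem_cbox hz hz' hbox₁
  by_cases himg₁ : IsGImg b z₁
  · -- the step lands on a genuine image site `a = z₁`; take one more step towards `z'`
    have hne₁ : z₁ ≠ z' := fun h => (isSpin_iff_not_isGImg.1 hz's) (h ▸ himg₁)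
    obtain ⟨z₂, hadj₂, hbox₂, hlt₂⟩ := exists_step_towards hne₁
    have hz₂B : z₂ ∈ supBall r y := mem_supBall_of_mem_cbox hz₁B hz' hbox₂
    have hz₂s : IsSpin b z₂ := isSpin_of_adj_isGImg hb himg₁ hadj₂
    have hlt : latL1Dist z₂ z' < n := by omega
    have hz₂ne : z₂ ≠ z := fun h => by rw [h] at hlt₂; omega
    -- how to conclude once `z₂` is reached through `-` spins
    have concl : σ z₂ = -1 →
        ∃ v ∈ supBall r y, ∃ v' ∈ supBall r y, IsSpin b v ∧ IsSpin b v' ∧ (zdGraph d).Adj v v' ∧ σ v = -1 ∧ σ v' = 1 :=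
      fun h2 => ih _ hlt z₂ hz₂B hz₂s h2 le_rfl
    -- unit steps `z = a + s eᵢ`, `z₂ = a + t eⱼ` (`a = z₁`)
    obtain ⟨⟨i, s⟩, hs, hzeq⟩ := exists_axisSign_of_adj hadj₁.symm
    obtain ⟨⟨j, t⟩, ht, hz₂eq⟩ := exists_axisSign_of_adj hadj₂
    simp only at hs hzeq ht hz₂eq
    have ha : IsSpImageSite d b z₁ := himg₁.1
    have hyz := mem_supBall_iff_forall.1 hz
    have hyz₁ := mem_supBall_iff_forall.1 hz₁B
    have hyz₂ := mem_supBall_iff_forall.1 hz₂B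
    have hzc : ∀ m, z m = z₁ m + if m = i then s else 0 := fun m => by rw [hzeq, add_zsmul_single_apply]
    have hz₂c : ∀ m, z₂ m = z₁ m + if m = j then t else 0 := fun m => by rw [hz₂eq, add_zsmul_single_apply]
    by_cases hij : i = j
    · -- straight through the image: `z₂ = a - s eᵢ`; detour in a direction `k ≠ i`
      subst hij
      have hts : t = -s := by
        rcases hs with rfl | rfl <;> rcases ht with rfl | rfl
        · exact absurd (funext fun m => by rw [hz₂c, hzc]) hz₂ne
        · rfl
        · rfl
        · exact absurd (funext fun m => by rw [hz₂c, hzc]) hz₂ne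
      obtain ⟨k, hki⟩ : ∃ k : Fin d, k ≠ i := by
        by_cases hi0 : i = ⟨0, by omega⟩
        · exact ⟨⟨1, by omega⟩, fun h => by rw [hi0] at h; exact absurd (congrArg Fin.val h) (by simp)⟩
        · exact ⟨⟨0, by omega⟩, fun h => hi0 h.symm⟩
      set c : ℤ := if z₁ k ≤ y k then 1 else -1 with hc
      have hc1 : c = 1 ∨ c = -1 := by rw [hc]; split_ifs <;> simp
      have hck : y k - r ≤ z₁ k + c ∧ z₁ k + c ≤ y k + r := by
        have := hyz₁ k; rw [hc]; split_ifs <;> omega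
      set w₁ : Site d := z + c • uvec k with hw₁
      set w₂ : Site d := z₁ + c • uvec k with hw₂
      set w₃ : Site d := z₂ + c • uvec k with hw₃
      have hw₁c : ∀ m, w₁ m = z m + if m = k then c else 0 := fun m => by rw [hw₁, add_zsmul_single_apply]
      have hw₂c : ∀ m, w₂ m = z₁ m + if m = k then c else 0 := fun m => by rw [hw₂, add_zsmul_single_apply]
      have hw₃c : ∀ m, w₃ m = z₂ m + if m = k then c else 0 := fun m => by rw [hw₃, add_zsmul_single_apply]
      -- in the ball
      have hw₁B : w₁ ∈ supBall r y := mem_supBall_iff_forall.2 fun m => by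
        rw [hw₁c, hzc]; have := hyz m; have := hzc m
        by_cases hmk : m = k
        · subst hmk; rw [if_neg hki, if_pos rfl]; omega
        · rw [if_neg hmk]; split_ifs <;> omega
      have hw₂B : w₂ ∈ supBall r y := mem_supBall_iff_forall.2 fun m => by
        rw [hw₂c]; have := hyz₁ m
        by_cases hmk : m = k
        · subst hmk; rw [if_pos rfl]; omega
        · rw [if_neg hmk]; omega
      have hw₃B : w₃ ∈ supBall r y := mem_supBall_iff_forall.2 fun m => by
        rw [hw₃c, hz₂c]; have := hyz₂ m; have := hz₂c m
        by_cases hmk : m = k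
        · subst hmk; rw [if_neg hki, if_pos rfl]; omega
        · rw [if_neg hmk]; split_ifs <;> omega
      -- spin sites
      have hw₁s : IsSpin b w₁ := isSpin_of_not_isSpImageSite
        (not_isSpImageSite_add_of_apply_eq hb ha k (by
          rw [hw₁c, hzc, if_neg hki, if_pos rfl]; rcases hc1 with h | h <;> [left; right] <;> omega))
      have hw₂s : IsSpin b w₂ := isSpin_of_not_isSpImageSite
        (not_isSpImageSite_add_of_apply_eq hb ha k (by
          rw [hw₂c, if_pos rfl]; rcases hc1 with h | h <;> [left; right] <;> omega))
      have hw₃s : IsSpin b w₃ := isSpin_of_not_isSpImageSite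
        (not_isSpImageSite_add_of_apply_eq hb ha k (by
          rw [hw₃c, hz₂c, if_neg hki, if_pos rfl]; rcases hc1 with h | h <;> [left; right] <;> omega))
      -- adjacencies
      have ha₁ : (zdGraph d).Adj z w₁ := zdGraph_adj_add_zsmul_single z k hc1
      have ha₂ : (zdGraph d).Adj w₁ w₂ := by
        have : w₁ = w₂ + s • (Pi.single i (1 : ℤ) : Site d) := by rw [hw₁, hw₂, hzeq]; abel
        rw [this]; exact (zdGraph_adj_add_zsmul_single w₂ i hs).symm
      have ha₃ : (zdGraph d).Adj w₂ w₃ := by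
        have : w₃ = w₂ + t • (Pi.single i (1 : ℤ) : Site d) := by rw [hw₃, hw₂, hz₂eq]; abel
        rw [this]; exact zdGraph_adj_add_zsmul_single w₂ i ht
      have ha₄ : (zdGraph d).Adj w₃ z₂ := (zdGraph_adj_add_zsmul_single z₂ k hc1).symm
      -- walk
      rcases Int.units_eq_one_or (σ w₁) with h₁ | h₁
      · exact ⟨z, hz, w₁, hw₁B, hzs, hw₁s, ha₁, hσz, h₁⟩
      rcases Int.units_eq_one_or (σ w₂) with h₂ | h₂
      · exact ⟨w₁, hw₁B, w₂, hw₂B, hw₁s, hw₂s, ha₂, h₁, h₂⟩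
      rcases Int.units_eq_one_or (σ w₃) with h₃ | h₃
      · exact ⟨w₂, hw₂B, w₃, hw₃B, hw₂s, hw₃s, ha₃, h₂, h₃⟩
      rcases Int.units_eq_one_or (σ z₂) with h₄ | h₄
      · exact ⟨w₃, hw₃B, z₂, hz₂B, hw₃s, hz₂s, ha₄, h₃, h₄⟩
      exact concl h₄
    · -- two different axes: cut the corner through `w = z + t eⱼ = z₂ + s eᵢ`
      set w : Site d := z + t • uvec j with hw
      have hwc : ∀ m, w m = z m + if m = j then t else 0 := fun m => by rw [hw, add_zsmul_single_apply]
      have hwB : w ∈ supBall r y := mem_supBall_iff_forall.2 fun m => by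
        rw [hwc]
        have h1 := hyz m; have h2 := hyz₂ m; have h3 := hz₂c m; have h4 := hzc m
        by_cases hmj : m = j
        · rw [if_pos hmj]
          rw [hmj] at h1 h2 h3 h4 ⊢
          rw [if_pos rfl] at h3
          rw [if_neg (fun h => hij h.symm)] at h4
          omega
        · rw [if_neg hmj]; omega
      have hws : IsSpin b w := isSpin_of_not_isSpImageSite
        (not_isSpImageSite_add_of_apply_eq hb ha i (by
          rw [hwc, hzc, if_pos rfl, if_neg hij]; rcases hs with h | h <;> [left; right] <;> omega))
      have ha₁ : (zdGraph d).Adj z w := zdGraph_adj_add_zsmul_single z j ht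
      have ha₂ : (zdGraph d).Adj w z₂ := by
        have : w = z₂ + s • (Pi.single i (1 : ℤ) : Site d) := by rw [hw, hz₂eq, hzeq]; abel
        rw [this]; exact (zdGraph_adj_add_zsmul_single z₂ i hs).symm
      rcases Int.units_eq_one_or (σ w) with h₁ | h₁
      · exact ⟨z, hz, w, hwB, hzs, hws, ha₁, hσz, h₁⟩
      rcases Int.units_eq_one_or (σ z₂) with h₂ | h₂
      · exact ⟨w, hwB, z₂, hz₂B, hws, hz₂s, ha₂, h₁, h₂⟩
      exact concl h₂
  · -- the step lands on a spin site
    have hz₁s : IsSpin b z₁ := isSpin_iff_not_isGImg.2 himg₁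
    rcases Int.units_eq_one_or (σ z₁) with h1 | h1
    · exact ⟨z, hz, z₁, hz₁B, hzs, hz₁s, hadj₁, hσz, h1⟩
    · exact ih _ (by omega) z₁ hz₁B hz₁s h1 le_rfl

end Bad

/-! ### Signs propagate; far sites are good -/

section Signs

variable {b r : ℕ} {p : ℤˣ} {R' : ℕ}

/-- Every site has a spin site at sup-distance `≤ 1` (itself, or its neighbour `y + e₀`; `d ≥ 1`, `b ≥ 2`).
[cite: VanenterFernandezSokal1993, §4.1.2 Step 1] -/
theorem exists_isSpin_supDist_le_one (hd : 1 ≤ d) (hb : 2 ≤ b) (y : Site d) : ∃ z, IsSpin b z ∧ supDist y z ≤ 1 := by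
  by_cases hy : IsSpin b y
  · exact ⟨y, hy, by simp⟩
  · have hyimg : IsSpImageSite d b y := by
      rw [isSpin_iff_not_isGImg, not_not] at hy; exact hy.1
    refine ⟨y + uvec ⟨0, by omega⟩, isSpin_of_adj_isSpImageSite hb hyimg (zdGraph_adj_add_uvec y _), supDist_add_uvec_le y _⟩

/-- **Signs propagate between `★`-adjacent good sites** (`r ≥ 2`): their balls share a spin site.
[cite: FriedliVelenik2017, §7.2.1 (labels are locally constant)] -/
theorem bsign_eq_of_supDist_le_one (hd : 1 ≤ d) (hb : 2 ≤ b) (hr : 2 ≤ r) {σ : SpinConfig (Site d)} {y y' : Site d}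
    (hy : ¬ IsBad b r σ y) (hy' : ¬ IsBad b r σ y') (h : supDist y y' ≤ 1) : bsign b r σ y = bsign b r σ y' := by
  obtain ⟨z, hzs, hz⟩ := exists_isSpin_supDist_le_one hd hb y
  have hz1 : z ∈ supBall r y := mem_supBall.2 (hz.trans (by omega))
  have hz2 : z ∈ supBall r y' := mem_supBall.2 (by
    have := supDist_triangle y' y z; rw [supDist_comm y' y] at this; omega)
  rw [bsign_eq_of_apply hy hz1 hzs, bsign_eq_of_apply hy' hz2 hzs]

/-- Signs propagate along `★`-chains of good sites. [cite: FriedliVelenik2017, §7.2.1] -/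
theorem bsign_eq_of_reflTransGen (hd : 1 ≤ d) (hb : 2 ≤ b) (hr : 2 ≤ r) {σ : SpinConfig (Site d)} {y y' : Site d}
    (h : ReflTransGen (starRel {w | ¬ IsBad b r σ w}) y y') : bsign b r σ y = bsign b r σ y' := by
  induction h with
  | refl => rfl
  | tail _ hbc ih => exact ih.trans (bsign_eq_of_supDist_le_one hd hb hr hbc.2.1 hbc.2.2 (zdStar_adj.1 hbc.1).2)

/-- The ball of a point outside `box (bR' + r)` misses `Λ_{R'}`. [folklore] -/
theorem not_mem_box_of_mem_supBall_of_not_mem {y z : Site d} (hy : y ∉ box d (b * R' + r)) (hz : z ∈ supBall r y) :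
    z ∉ box d (b * R') := by
  intro hzbox
  apply hy
  rw [mem_box] at hzbox ⊢
  intro i
  have h1 := hzbox i
  have h2 := (mem_supBall_iff_forall.1 hz) i
  push_cast
  omega

/-- **A good site with sign `-1` lies in `box (bR' + r)`**: its ball contains a `-` spin site, which
lies in `W(R') ⊆ Λ_{R'}`. [cite: VanenterFernandezSokal1993, §4.3.1 Step 2] -/
theorem mem_box_of_bsign_eq_neg_one (hd : 1 ≤ d) (hb : 2 ≤ b) (hr : 1 ≤ r) {σ : SpinConfig (Site d)} (hσ : IsCfg b p R' σ)
    {y : Site d} (hy : ¬ IsBad b r σ y) (hs : bsign b r σ y = -1) : y ∈ box d (b * R' + r) := by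
  by_contra hfar
  obtain ⟨z, hzs, hz⟩ := exists_isSpin_supDist_le_one hd hb y
  have hzB : z ∈ supBall r y := mem_supBall.2 (hz.trans hr)
  have h1 : σ z = 1 := hσ.apply_eq_one_of_not_mem_box hzs (not_mem_box_of_mem_supBall_of_not_mem hfar hzB)
  rw [apply_eq_bsign hy hzB hzs, hs] at h1
  exact absurd h1 (by decide)

/-- **A bad site lies in `box (bR' + r)`**: its ball contains a `-` spin site. [cite: VanenterFernandezSokal1993, §4.3.1 Step 2] -/
theorem mem_box_of_isBad {σ : SpinConfig (Site d)} (hσ : IsCfg b p R' σ) {y : Site d} (hy : IsBad b r σ y) :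
    y ∈ box d (b * R' + r) := by
  by_contra hfar
  obtain ⟨z, hz, z', hz', hzs, hz's, hne⟩ := hy
  rw [hσ.apply_eq_one_of_not_mem_box hzs (not_mem_box_of_mem_supBall_of_not_mem hfar hz),
    hσ.apply_eq_one_of_not_mem_box hz's (not_mem_box_of_mem_supBall_of_not_mem hfar hz')] at hne
  exact hne rfl

/-- Far sites are good. [cite: FriedliVelenik2017, §7.2.1] -/
theorem not_isBad_of_not_mem_box {σ : SpinConfig (Site d)} (hσ : IsCfg b p R' σ) {y : Site d} (hy : y ∉ box d (b * R' + r)) :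
    ¬ IsBad b r σ y := fun h => hy (mem_box_of_isBad hσ h)

/-- Far sites have sign `+1`. [cite: FriedliVelenik2017, §7.2.1] -/
theorem bsign_eq_one_of_not_mem_box (hd : 1 ≤ d) (hb : 2 ≤ b) (hr : 1 ≤ r) {σ : SpinConfig (Site d)} (hσ : IsCfg b p R' σ)
    {y : Site d} (hy : y ∉ box d (b * R' + r)) : bsign b r σ y = 1 := by
  rcases bsign_eq_or (b := b) (r := r) σ y with h | h
  · exact h
  · exact absurd (mem_box_of_bsign_eq_neg_one hd hb hr hσ (not_isBad_of_not_mem_box hσ hy) h) hy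

/-- A spin site carrying `-1` is bad or has sign `-1`. [cite: FriedliVelenik2017, §7.2.1] -/
theorem isBad_or_bsign_eq_neg_one {σ : SpinConfig (Site d)} {x : Site d} (hxs : IsSpin b x) (hx : σ x = -1) :
    IsBad b r σ x ∨ (¬ IsBad b r σ x ∧ bsign b r σ x = -1) := by
  by_cases h : IsBad b r σ x
  · exact Or.inl h
  · exact Or.inr ⟨h, by rw [bsign_eq_of_apply h (mem_supBall_self r x) hxs, hx]⟩

end Signs

/-! ### `★`-components inside a finite set -/

section Components

/-- **The `★`-component of `z₀` inside the finite set `F`.** [cite: FriedliVelenik2017, §7.2.6 (connected components)] -/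
def starCompIn (F : Finset (Site d)) (z₀ : Site d) : Finset (Site d) :=
  open Classical in F.filter fun z => ReflTransGen (starRel (F : Set (Site d))) z₀ z

/-- Membership in `starCompIn`. [cite: FriedliVelenik2017, §7.2.6] -/
theorem mem_starCompIn {F : Finset (Site d)} {z₀ z : Site d} (hz₀ : z₀ ∈ F) :
    z ∈ starCompIn F z₀ ↔ ReflTransGen (starRel (F : Set (Site d))) z₀ z := by
  classical
  rw [starCompIn, mem_filter]
  exact ⟨fun h => h.2, fun h => ⟨mem_of_reflTransGen_starRel h hz₀, h⟩⟩

/-- A component lies in the set. [folklore] -/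
theorem starCompIn_subset (F : Finset (Site d)) (z₀ : Site d) : starCompIn F z₀ ⊆ F := by
  classical
  exact filter_subset _ _

/-- The base point lies in its component. [folklore] -/
theorem mem_starCompIn_self {F : Finset (Site d)} {z₀ : Site d} (hz₀ : z₀ ∈ F) : z₀ ∈ starCompIn F z₀ :=
  (mem_starCompIn hz₀).2 ReflTransGen.refl

/-- Components are closed under `★`-steps inside `F` (maximality). [cite: FriedliVelenik2017, §7.2.6] -/
theorem mem_starCompIn_of_adj {F : Finset (Site d)} {z₀ z w : Site d} (hz₀ : z₀ ∈ F) (hz : z ∈ starCompIn F z₀)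
    (hw : w ∈ F) (hadj : (zdStar d).Adj z w) : w ∈ starCompIn F z₀ :=
  (mem_starCompIn hz₀).2 (((mem_starCompIn hz₀).1 hz).tail ⟨hadj, starCompIn_subset F z₀ hz, hw⟩)

/-- **Components are `★`-connected.** [cite: FriedliVelenik2017, §7.2.6] -/
theorem starConn_starCompIn {F : Finset (Site d)} {z₀ : Site d} (hz₀ : z₀ ∈ F) :
    StarConn (starCompIn F z₀ : Set (Site d)) := by
  intro a ha c hc
  have hac : ReflTransGen (starRel (F : Set (Site d))) a c :=
    (reflTransGen_starRel_symm ((mem_starCompIn hz₀).1 ha)).trans ((mem_starCompIn hz₀).1 hc)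
  exact reflTransGen_starRel_restrict
    (fun a ha c hac => mem_coe.2 (mem_starCompIn_of_adj hz₀ (mem_coe.1 ha) hac.2.2 hac.1)) ha hac

/-- Components through chained points coincide. [folklore] -/
theorem starCompIn_eq_of_mem {F : Finset (Site d)} {z₀ z : Site d} (hz₀ : z₀ ∈ F) (hz : z ∈ starCompIn F z₀) :
    starCompIn F z = starCompIn F z₀ := by
  have hzF : z ∈ F := starCompIn_subset F z₀ hz
  have h0z := (mem_starCompIn hz₀).1 hz
  ext w
  rw [mem_starCompIn hzF, mem_starCompIn hz₀]
  exact ⟨fun h => h0z.trans h, fun h => (reflTransGen_starRel_symm h0z).trans h⟩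

/-- **Maximality**: the exterior `★`-boundary of a component misses `F`. [cite: FriedliVelenik2017, §7.2.6] -/
theorem not_mem_of_mem_exBoundary_starCompIn {F : Finset (Site d)} {z₀ y : Site d} (hz₀ : z₀ ∈ F)
    (hy : y ∈ exBoundary (starCompIn F z₀)) : y ∉ F := by
  obtain ⟨hyC, x, hx, hadj⟩ := mem_exBoundary.1 hy
  exact fun hyF => hyC (mem_starCompIn_of_adj hz₀ hx hyF hadj)

/-- A `★`-connected subset of `F` meeting a component lies in it. [cite: FriedliVelenik2017, §7.2.6] -/
theorem subset_starCompIn_of_starConn {F T : Finset (Site d)} {z₀ t : Site d} (hz₀ : z₀ ∈ F)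
    (hT : StarConn (T : Set (Site d))) (hTF : T ⊆ F) (ht : t ∈ T) (htC : t ∈ starCompIn F z₀) : T ⊆ starCompIn F z₀ := by
  intro w hw
  have := hT t (mem_coe.2 ht) w (mem_coe.2 hw)
  exact (mem_starCompIn hz₀).2 (((mem_starCompIn hz₀).1 htC).trans
    (reflTransGen_starRel_mono (fun x hx => mem_coe.2 (hTF (mem_coe.1 hx))) this))

/-- The exterior `★`-boundary of a nonempty finite set is nonempty (`d ≥ 1`): step up in the first
coordinate from a point maximising it. (A private copy of `RCC.exBoundary_nonempty` of
`RCContourWF.lean`, to avoid importing the random-cluster contour files.) [folklore] -/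
private theorem exBoundary_nonempty (hd : 1 ≤ d) {A : Finset (Site d)} (hA : A.Nonempty) : (exBoundary A).Nonempty := by
  obtain ⟨x, hx, hmax⟩ := exists_max_image A (fun x : Site d => x ⟨0, by omega⟩) hA
  refine ⟨x + uvec ⟨0, by omega⟩, mem_exBoundary.2 ⟨fun h => ?_, x, hx, zdGraph_le_zdStar (zdGraph_adj_add_uvec x _)⟩⟩
  have := hmax _ h
  rw [Pi.add_apply, uvec_apply, if_pos rfl] at this
  omega

end Components

/-! ### Contours: `★`-components of the bad set; external contours around `-` spins -/

section Contours

variable {b r : ℕ} {p : ℤˣ} {R' : ℕ}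

variable (b r) in
/-- **`S` is a contour of `σ`**: a set of bad sites whose exterior `★`-boundary consists of good sites
(with `S` `★`-connected: a `★`-component of the bad set; Friedli–Velenik §7.2.6).
[cite: FriedliVelenik2017, §7.2.6 (contours as connected components of the incorrect set)] -/
def IsContour (σ : SpinConfig (Site d)) (S : Finset (Site d)) : Prop :=
  (∀ y ∈ S, IsBad b r σ y) ∧ ∀ y ∈ exBoundary S, ¬ IsBad b r σ y

variable (b r) in
/-- **The contour `S` has exterior label `+`**: the good sites `★`-adjacent to `S` on the exterior
side have sign `+1` (an "external contour of type `+`", Friedli–Velenik §7.2.6).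
[cite: FriedliVelenik2017, §7.2.6 (type of a contour)] -/
def IsPlusExt (σ : SpinConfig (Site d)) (S : Finset (Site d)) : Prop :=
  ∀ y ∈ exBoundary S, y ∈ starExt S → bsign b r σ y = 1

variable (b r R') in
/-- **The bad set as a finite set** (it lies in `box (bR' + r)`). [cite: FriedliVelenik2017, §7.2.1] -/
def badFinset (σ : SpinConfig (Site d)) : Finset (Site d) :=
  open Classical in (box d (b * R' + r)).filter (IsBad b r σ)

/-- Membership in `badFinset`. [cite: FriedliVelenik2017, §7.2.1] -/
theorem mem_badFinset {σ : SpinConfig (Site d)} (hσ : IsCfg b p R' σ) {y : Site d} :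
    y ∈ badFinset b r R' σ ↔ IsBad b r σ y := by
  classical
  rw [badFinset, mem_filter]
  exact ⟨fun h => h.2, fun h => ⟨mem_box_of_isBad hσ h, h⟩⟩

/-- `badFinset ⊆ box (bR' + r)`. [folklore] -/
theorem badFinset_subset_box (σ : SpinConfig (Site d)) : badFinset b r R' σ ⊆ box d (b * R' + r) := by
  classical
  exact filter_subset _ _

/-- **`★`-components of the bad set are contours.** [cite: FriedliVelenik2017, §7.2.6] -/
theorem isContour_starCompIn {σ : SpinConfig (Site d)} (hσ : IsCfg b p R' σ) {z₀ : Site d} (hz₀ : IsBad b r σ z₀) :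
    IsContour b r σ (starCompIn (badFinset b r R' σ) z₀) := by
  have hz₀' := (mem_badFinset hσ).2 hz₀
  exact ⟨fun y hy => (mem_badFinset hσ).1 (starCompIn_subset _ _ hy),
    fun y hy hyb => not_mem_of_mem_exBoundary_starCompIn hz₀' hy ((mem_badFinset hσ).2 hyb)⟩

/-- **The good component of a good site of sign `-1`**: the good sites `★`-chained to it through good
sites; all of them have sign `-1`, so the component is finite (inside `box (bR' + r)`).
[cite: FriedliVelenik2017, §7.2.6] -/
def goodComp (b r R' : ℕ) (σ : SpinConfig (Site d)) (y : Site d) : Finset (Site d) :=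
  open Classical in (box d (b * R' + r)).filter fun z => ReflTransGen (starRel {w | ¬ IsBad b r σ w}) y z

/-- Membership in `goodComp`. [cite: FriedliVelenik2017, §7.2.6] -/
theorem mem_goodComp (hd : 1 ≤ d) (hb : 2 ≤ b) (hr : 2 ≤ r) {σ : SpinConfig (Site d)} (hσ : IsCfg b p R' σ) {y : Site d}
    (hy : ¬ IsBad b r σ y) (hs : bsign b r σ y = -1) {z : Site d} :
    z ∈ goodComp b r R' σ y ↔ ReflTransGen (starRel {w | ¬ IsBad b r σ w}) y z := by
  classical
  rw [goodComp, mem_filter]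
  refine ⟨fun h => h.2, fun h => ⟨?_, h⟩⟩
  have hz : ¬ IsBad b r σ z := mem_of_reflTransGen_starRel h hy
  exact mem_box_of_bsign_eq_neg_one hd hb (by omega) hσ hz ((bsign_eq_of_reflTransGen hd hb hr h).symm.trans hs)

/-- **Enclosure lemma**: a good site of sign `-1` lies in the interior of some contour — the
`★`-component of the bad set containing the exterior `★`-boundary of the hull of its good component
(that boundary is `★`-connected by Friedli–Velenik Lemma 7.19 and consists of bad sites).
[cite: FriedliVelenik2017, §7.2.6, Lemma 7.19] -/
theorem exists_contour_of_bsign_eq_neg_one (hd : 2 ≤ d) (hb : 2 ≤ b) (hr : 2 ≤ r) {σ : SpinConfig (Site d)}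
    (hσ : IsCfg b p R' σ) {y : Site d} (hy : ¬ IsBad b r σ y) (hs : bsign b r σ y = -1) :
    ∃ z₀, IsBad b r σ z₀ ∧ y ∉ starCompIn (badFinset b r R' σ) z₀ ∧ y ∉ starExt (starCompIn (badFinset b r R' σ) z₀) := by
  classical
  have hd1 : 1 ≤ d := by omega
  set C := goodComp b r R' σ y with hCdef
  have hyC : y ∈ C := (mem_goodComp hd1 hb hr hσ hy hs).2 ReflTransGen.refl
  have hCgood : ∀ z ∈ C, ¬ IsBad b r σ z := fun z hz =>
    mem_of_reflTransGen_starRel ((mem_goodComp hd1 hb hr hσ hy hs).1 hz) hy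
  -- `C` is `★`-connected and closed under `★`-steps through good sites
  have hCclosed : ∀ a ∈ (C : Set (Site d)), ∀ c, starRel {w | ¬ IsBad b r σ w} a c → c ∈ (C : Set (Site d)) :=
    fun a ha c hac => mem_coe.2 ((mem_goodComp hd1 hb hr hσ hy hs).2 (((mem_goodComp hd1 hb hr hσ hy hs).1 (mem_coe.1 ha)).tail hac))
  have hCconn : StarConn (C : Set (Site d)) := by
    intro a ha c hc
    have hac : ReflTransGen (starRel {w | ¬ IsBad b r σ w}) a c :=
      (reflTransGen_starRel_symm ((mem_goodComp hd1 hb hr hσ hy hs).1 (mem_coe.1 ha))).trans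
        ((mem_goodComp hd1 hb hr hσ hy hs).1 (mem_coe.1 hc))
    exact reflTransGen_starRel_restrict hCclosed ha hac
  -- the exterior boundary of the hull of `C` consists of bad sites
  set B := exBoundary (starHullFinset C) with hBdef
  have hBbad : ∀ z ∈ B, IsBad b r σ z := by
    intro z hz
    obtain ⟨hzH, w, hw, hadj⟩ := mem_exBoundary.1 hz
    rw [mem_starHullFinset hd] at hzH hw
    have hzext : z ∈ starExt C := by by_contra h; exact hzH h
    -- `w ∈ C`: otherwise `w` is interior and `★`-adjacent to the exterior point `z`
    have hwC : w ∈ C := by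
      by_contra hwC
      have : w ∈ starExt C := mem_starExt_of_reflTransGen hzext (ReflTransGen.single ⟨hadj.symm, hzext.1, hwC⟩)
      exact hw this
    by_contra hzgood
    exact hzext.1 (mem_coe.1 (hCclosed w (mem_coe.2 hwC) z ⟨hadj, hCgood w hwC, hzgood⟩))
  have hBconn : StarConn (B : Set (Site d)) := (starConn_boundaries_starHull hd hCconn).1
  have hBne : B.Nonempty := exBoundary_nonempty hd1 ⟨y, (mem_starHullFinset hd).2 (subset_starHull C (mem_coe.2 hyC))⟩
  obtain ⟨z₀, hz₀⟩ := hBne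
  have hz₀bad : IsBad b r σ z₀ := hBbad z₀ hz₀
  have hz₀F : z₀ ∈ badFinset b r R' σ := (mem_badFinset hσ).2 hz₀bad
  set S := starCompIn (badFinset b r R' σ) z₀ with hSdef
  have hBS : B ⊆ S := subset_starCompIn_of_starConn hz₀F hBconn (fun z hz => (mem_badFinset hσ).2 (hBbad z hz)) hz₀
    (mem_starCompIn_self hz₀F)
  refine ⟨z₀, hz₀bad, fun hyS => hy ((mem_badFinset hσ).1 (starCompIn_subset _ _ hyS)), fun hyext => ?_⟩
  -- a chain from `y` to a far point inside `Sᶜ` must leave the hull of `C` through `B ⊆ S`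
  have hSbox : S ⊆ box d (b * R' + r) := (starCompIn_subset _ _).trans (badFinset_subset_box σ)
  have hCbox : C ⊆ box d (b * R' + r) := by intro z hz; exact (mem_filter.1 hz).1
  rw [mem_starExt_iff hd hSbox] at hyext
  obtain ⟨-, yfar, hyfar, hchain⟩ := hyext
  have hfarH : yfar ∉ starHull C := fun h =>
    (mem_farSet_iff_not_mem_box.1 hyfar) (starHull_subset_box hd hCbox h)
  have key : ∀ w, ReflTransGen (starRel (S : Set (Site d))ᶜ) y w → w ∈ starHull C := by
    intro w hw
    induction hw with
    | refl => exact subset_starHull C (mem_coe.2 hyC)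
    | @tail a c _ hac ih =>
      by_contra hcH
      have hcB : c ∈ B := mem_exBoundary.2
        ⟨fun h => hcH ((mem_starHullFinset hd).1 h), a, (mem_starHullFinset hd).2 ih, hac.1⟩
      exact hac.2.2 (hBS hcB)
  exact hfarH (key yfar hchain)

/-- **Every `-` spin site lies inside or on some contour.** [cite: FriedliVelenik2017, §7.2.6] -/
theorem exists_isBad_not_mem_starExt (hd : 2 ≤ d) (hb : 2 ≤ b) (hr : 2 ≤ r) {σ : SpinConfig (Site d)} (hσ : IsCfg b p R' σ)
    {x : Site d} (hxs : IsSpin b x) (hx : σ x = -1) :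
    ∃ z₀, IsBad b r σ z₀ ∧ x ∉ starExt (starCompIn (badFinset b r R' σ) z₀) := by
  rcases isBad_or_bsign_eq_neg_one (r := r) hxs hx with h | ⟨h, hs⟩
  · exact ⟨x, h, fun hext => hext.1 (mem_starCompIn_self ((mem_badFinset hσ).2 h))⟩
  · obtain ⟨z₀, hz₀, -, hext⟩ := exists_contour_of_bsign_eq_neg_one hd hb hr hσ h hs
    exact ⟨z₀, hz₀, hext⟩

/-- Adding a `★`-adjacent point keeps a set `★`-connected. [folklore] -/
theorem starConn_insert_of_adj {A : Finset (Site d)} (hA : StarConn (A : Set (Site d))) {a y : Site d} (ha : a ∈ A)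
    (hadj : (zdStar d).Adj a y) : StarConn ((insert y A : Finset (Site d)) : Set (Site d)) := by
  classical
  have hsub : (A : Set (Site d)) ⊆ ((insert y A : Finset (Site d)) : Set (Site d)) := fun z hz => by
    rw [mem_coe, mem_insert]; exact Or.inr (mem_coe.1 hz)
  have hreach : ∀ u ∈ ((insert y A : Finset (Site d)) : Set (Site d)),
      ReflTransGen (starRel ((insert y A : Finset (Site d)) : Set (Site d))) a u := by
    intro u hu
    rw [mem_coe, mem_insert] at hu
    rcases hu with rfl | hu
    · exact ReflTransGen.single ⟨hadj, hsub (mem_coe.2 ha), mem_coe.2 (mem_insert_self _ _)⟩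
    · exact reflTransGen_starRel_mono hsub (hA a (mem_coe.2 ha) u (mem_coe.2 hu))
  intro u hu w hw
  exact (reflTransGen_starRel_symm (hreach u hu)).trans (hreach w hw)

/-- **Hull comparison**: if a contour `S''` strictly encloses a good site `y` exterior-adjacent to the
contour `S ∌ y`, then the exterior of `S''` is contained in the exterior of `S` (the two contours are
`★`-separated, so `S ∪ {y}` lies in one interior component of `S''`).
[cite: FriedliVelenik2017, §7.3 (trichotomy: compatible contours are nested or hull-disjoint), Lemma 7.23] -/
theorem starExt_subset_starExt (hd : 2 ≤ d) {S S'' : Finset (Site d)} {R : ℕ} (hSR : S ⊆ box d R) (hS''R : S'' ⊆ box d R)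
    (hS : StarConn (S : Set (Site d))) (hdisj : Disjoint S S'') {y : Site d} (hyS : y ∈ exBoundary S)
    (hy1 : y ∉ S'') (hy2 : y ∉ starExt S'') : starExt S'' ⊆ starExt S := by
  classical
  have hd1 : 1 ≤ d := by omega
  obtain ⟨hyS', a, ha, hadj⟩ := mem_exBoundary.1 hyS
  -- `S ∪ {y}` lies in the interior component of `S''` through `y`
  have hT : StarConn ((insert y S : Finset (Site d)) : Set (Site d)) := starConn_insert_of_adj hS ha hadj
  have hTdisj : Disjoint ((insert y S : Finset (Site d)) : Set (Site d)) (S'' : Set (Site d)) := by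
    rw [Set.disjoint_left]
    intro z hz hz''
    rw [mem_coe, mem_insert] at hz
    rcases hz with rfl | hz
    · exact hy1 (mem_coe.1 hz'')
    · exact disjoint_left.1 hdisj hz (mem_coe.1 hz'')
  have hyint : y ∈ starInt S'' := (mem_starInt hd).2 ⟨hy1, hy2⟩
  have hsub := subset_starIntComp_of_starConn hd hT hTdisj (mem_coe.2 (mem_insert_self y S)) hyint
  -- hence `S` misses the exterior of `S''`
  have hSext : Disjoint (starExt S'') (S : Set (Site d)) := by
    rw [Set.disjoint_left]
    intro z hz hzS
    have hz' : z ∈ starInt S'' := starIntComp_subset S'' y (mem_coe.1 (hsub (by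
      rw [mem_coe, mem_insert]; exact Or.inr (mem_coe.1 hzS))))
    exact ((mem_starInt hd).1 hz').2 hz
  -- and the exterior of `S''` is a `★`-connected set through a far point
  have hfar : (fun _ => (R : ℤ) + 1) ∉ box d R := fun h => by
    have := (mem_box.1 h) ⟨0, hd1⟩; omega
  exact subset_starExt_of_starConn (starConn_starExt hd S'') hSext (mem_starExt_of_not_mem_box hd hS''R hfar)
    (mem_starExt_of_not_mem_box hd hSR hfar)

/-- **External contours**: every `-` spin site lies inside or on a contour whose exterior label is `+`
— a contour of maximal hull among those enclosing the site (if an exterior-adjacent good site had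
sign `-`, the enclosure lemma would produce a strictly larger enclosing contour).
[cite: FriedliVelenik2017, §7.2.6 and §7.3 (external contours)] -/
theorem exists_plusExt_contour (hd : 2 ≤ d) (hb : 2 ≤ b) (hr : 2 ≤ r) {σ : SpinConfig (Site d)} (hσ : IsCfg b p R' σ)
    {x : Site d} (hxs : IsSpin b x) (hx : σ x = -1) :
    ∃ S : Finset (Site d), S.Nonempty ∧ StarConn (S : Set (Site d)) ∧ IsContour b r σ S ∧ IsPlusExt b r σ S ∧
      x ∉ starExt S := by
  classical
  set F := badFinset b r R' σ with hF
  set 𝒞 : Finset (Finset (Site d)) := (F.image (starCompIn F)).filter fun S => x ∉ starExt S with h𝒞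
  have h𝒞ne : 𝒞.Nonempty := by
    obtain ⟨z₀, hz₀, hx₀⟩ := exists_isBad_not_mem_starExt hd hb hr hσ hxs hx
    exact ⟨_, mem_filter.2 ⟨mem_image_of_mem _ ((mem_badFinset hσ).2 hz₀), hx₀⟩⟩
  obtain ⟨S, hS𝒞, hmax⟩ := exists_max_image 𝒞 (fun S => #(starHullFinset S)) h𝒞ne
  obtain ⟨hSimg, hxS⟩ := mem_filter.1 hS𝒞
  obtain ⟨z₀, hz₀F, rfl⟩ := mem_image.1 hSimg
  have hz₀ : IsBad b r σ z₀ := (mem_badFinset hσ).1 hz₀F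
  have hcont := isContour_starCompIn hσ hz₀
  have hconn := starConn_starCompIn hz₀F
  refine ⟨_, ⟨z₀, mem_starCompIn_self hz₀F⟩, hconn, hcont, fun y hy hyext => ?_, hxS⟩
  -- exterior label `+`, by maximality
  rcases bsign_eq_or (b := b) (r := r) σ y with h1 | h1
  · exact h1
  exfalso
  have hygood : ¬ IsBad b r σ y := hcont.2 y hy
  obtain ⟨z₁, hz₁, hy1, hy2⟩ := exists_contour_of_bsign_eq_neg_one hd hb hr hσ hygood h1
  have hz₁F : z₁ ∈ F := (mem_badFinset hσ).2 hz₁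
  set S'' := starCompIn F z₁ with hS''
  -- the two contours are different components, hence disjoint
  have hdisj : Disjoint (starCompIn F z₀) S'' := by
    rw [disjoint_left]
    intro w hw hw''
    have h : starCompIn F z₀ = S'' :=
      ((starCompIn_eq_of_mem hz₀F hw).symm.trans (starCompIn_eq_of_mem hz₁F hw'')).trans hS''.symm
    rw [h] at hyext
    exact hy2 hyext
  have hsub : starExt S'' ⊆ starExt (starCompIn F z₀) :=
    starExt_subset_starExt hd ((starCompIn_subset _ _).trans (badFinset_subset_box σ))
      ((starCompIn_subset _ _).trans (badFinset_subset_box σ)) hconn hdisj hy hy1 hy2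
  -- so `S''` encloses `x` and has a strictly larger hull
  have hS''𝒞 : S'' ∈ 𝒞 := mem_filter.2 ⟨mem_image_of_mem _ hz₁F, fun h => hxS (hsub h)⟩
  have hlt : #(starHullFinset (starCompIn F z₀)) < #(starHullFinset S'') := by
    refine card_lt_card ⟨fun w hw => ?_, fun h => ?_⟩
    · rw [mem_starHullFinset hd] at hw ⊢
      exact fun h => hw (hsub h)
    · have : y ∈ starHullFinset S'' := (mem_starHullFinset hd).2 hy2
      exact ((mem_starHullFinset hd).1 (h this)) hyext
  exact absurd (hmax S'' hS''𝒞) (not_le.2 hlt)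

end Contours


/-! ### Interior components of a contour, their labels, and the rim lemma -/

section Interior

variable {b r : ℕ} {p : ℤˣ} {R' : ℕ}

/-- **The interior components of (the complement of) `S`**, indexed through the exterior-adjacent
interior points (every component of `Sᶜ` is `★`-adjacent to `S`).
[cite: FriedliVelenik2017, §7.2.6, eq. (7.22)] -/
def Comps (S : Finset (Site d)) : Finset (Finset (Site d)) := ((exBoundary S).filter (· ∈ starInt S)).image (starIntComp S)

/-- There are at most `3^d |S|` interior components. [cite: FriedliVelenik2017, Lemma 7.30 (entropy bounds)] -/
theorem card_Comps_le (S : Finset (Site d)) : #(Comps S) ≤ 3 ^ d * #S := by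
  classical
  calc #(Comps S) ≤ #((exBoundary S).filter (· ∈ starInt S)) := card_image_le
    _ ≤ #(exBoundary S) := card_filter_le _ _
    _ ≤ #(S.biUnion starBall) := card_le_card sdiff_subset
    _ ≤ ∑ s ∈ S, #(starBall s) := card_biUnion_le
    _ = 3 ^ d * #S := by simp [card_starBall, mul_comm]

/-- Membership in `Comps`. [cite: FriedliVelenik2017, §7.2.6] -/
theorem mem_Comps {S : Finset (Site d)} {A : Finset (Site d)} :
    A ∈ Comps S ↔ ∃ y ∈ exBoundary S, y ∈ starInt S ∧ starIntComp S y = A := by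
  classical
  simp only [Comps, mem_image, mem_filter, and_assoc]

/-- Components lie in the interior. [cite: FriedliVelenik2017, §7.2.6] -/
theorem subset_starInt_of_mem_Comps {S A : Finset (Site d)} (hA : A ∈ Comps S) : A ⊆ starInt S := by
  obtain ⟨y, -, -, rfl⟩ := mem_Comps.1 hA
  exact starIntComp_subset S y

/-- Components miss `S` and the exterior. [cite: FriedliVelenik2017, §7.2.6] -/
theorem not_mem_of_mem_Comps (hd : 2 ≤ d) {S A : Finset (Site d)} (hA : A ∈ Comps S) {w : Site d} (hw : w ∈ A) :
    w ∉ S ∧ w ∉ starExt S :=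
  (mem_starInt hd).1 (subset_starInt_of_mem_Comps hA hw)

/-- **Components are closed under `★`-steps avoiding `S`.** [cite: FriedliVelenik2017, §7.2.6] -/
theorem mem_of_mem_Comps_of_adj (hd : 2 ≤ d) {S A : Finset (Site d)} (hA : A ∈ Comps S) {w z : Site d} (hw : w ∈ A)
    (hadj : (zdStar d).Adj w z) (hz : z ∉ S) : z ∈ A := by
  obtain ⟨y, -, hy, rfl⟩ := mem_Comps.1 hA
  exact mem_starIntComp_of_starRel hd hy hw ⟨hadj, (not_mem_of_mem_Comps hd hA hw).1, hz⟩

/-- A `★`-neighbour of a component outside the component lies in `S`. [cite: FriedliVelenik2017, §7.2.6] -/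
theorem mem_of_adj_of_not_mem (hd : 2 ≤ d) {S A : Finset (Site d)} (hA : A ∈ Comps S) {w z : Site d} (hw : w ∈ A)
    (hadj : (zdStar d).Adj w z) (hz : z ∉ A) : z ∈ S := by
  by_contra h
  exact hz (mem_of_mem_Comps_of_adj hd hA hw hadj h)

/-- **Every interior point lies in a component.** [cite: FriedliVelenik2017, §7.2.6, eq. (7.22)] -/
theorem exists_mem_Comps (hd : 2 ≤ d) {S : Finset (Site d)} (hSne : S.Nonempty) {w : Site d} (hw : w ∈ starInt S) :
    ∃ A ∈ Comps S, w ∈ A := by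
  obtain ⟨y, z, hz, hyz, hwy⟩ := exists_reflTransGen_adj_of_not_mem hSne ((mem_starInt hd).1 hw).1
  have hyA : y ∈ starIntComp S w := (mem_starIntComp hd hw).2 hwy
  have hyint : y ∈ starInt S := starIntComp_subset S w hyA
  refine ⟨starIntComp S y, mem_Comps.2 ⟨y, mem_exBoundary.2 ⟨((mem_starInt hd).1 hyint).1, z, hz, hyz.symm⟩, hyint, rfl⟩, ?_⟩
  rw [starIntComp_eq_of_mem hd hw hyA]
  exact mem_starIntComp_self hd hw

/-- Two components sharing a point are equal. [cite: FriedliVelenik2017, §7.2.6] -/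
theorem Comps_eq_of_mem (hd : 2 ≤ d) {S A A' : Finset (Site d)} (hA : A ∈ Comps S) (hA' : A' ∈ Comps S) {w : Site d}
    (hw : w ∈ A) (hw' : w ∈ A') : A = A' := by
  obtain ⟨y, -, hy, rfl⟩ := mem_Comps.1 hA
  obtain ⟨y', -, hy', rfl⟩ := mem_Comps.1 hA'
  rw [← starIntComp_eq_of_mem hd hy hw, ← starIntComp_eq_of_mem hd hy' hw']

/-- Components are `★`-connected. [cite: FriedliVelenik2017, §7.2.6] -/
theorem starConn_of_mem_Comps (hd : 2 ≤ d) {S A : Finset (Site d)} (hA : A ∈ Comps S) : StarConn (A : Set (Site d)) := by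
  obtain ⟨y, -, hy, rfl⟩ := mem_Comps.1 hA
  exact starConn_starIntComp hd hy

/-- **Points of the interior boundary of a component are exterior-adjacent to `S`**, hence good on
the event that `S` is a contour. [cite: FriedliVelenik2017, §7.2.6] -/
theorem mem_exBoundary_of_mem_inBoundary (hd : 2 ≤ d) {S A : Finset (Site d)} (hA : A ∈ Comps S) {y : Site d}
    (hy : y ∈ inBoundary A) : y ∈ exBoundary S := by
  obtain ⟨hyA, z, hz, hadj⟩ := mem_inBoundary.1 hy
  exact mem_exBoundary.2 ⟨(not_mem_of_mem_Comps hd hA hyA).1, z, mem_of_adj_of_not_mem hd hA hyA hadj hz, hadj.symm⟩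

/-- **Labels are well defined**: on a contour, the sign is constant on the interior boundary of each
interior component (that boundary is `★`-connected, Friedli–Velenik Lemma 7.19, and consists of good
sites). [cite: FriedliVelenik2017, §7.2.6, Lemma 7.19 (labels)] -/
theorem bsign_eq_of_mem_inBoundary (hd : 2 ≤ d) (hb : 2 ≤ b) (hr : 2 ≤ r) {σ : SpinConfig (Site d)} {S A : Finset (Site d)}
    (hS : StarConn (S : Set (Site d))) (hcont : IsContour b r σ S) (hA : A ∈ Comps S) {y y' : Site d}
    (hy : y ∈ inBoundary A) (hy' : y' ∈ inBoundary A) : bsign b r σ y = bsign b r σ y' := by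
  obtain ⟨y₀, -, hy₀, rfl⟩ := mem_Comps.1 hA
  have hconn := (starConn_boundaries_starIntComp hd hS hy₀).1
  have hgood : ((inBoundary (starIntComp S y₀) : Finset (Site d)) : Set (Site d)) ⊆ {w | ¬ IsBad b r σ w} :=
    fun w hw => hcont.2 w (mem_exBoundary_of_mem_inBoundary hd hA (mem_coe.1 hw))
  exact bsign_eq_of_reflTransGen (by omega) hb hr (reflTransGen_starRel_mono hgood (hconn y (mem_coe.2 hy) y' (mem_coe.2 hy')))

variable (b r) in
/-- **A `-` component**: an interior component all of whose interior-boundary sites have sign `-1`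
(label `-`, Friedli–Velenik §7.2.6). [cite: FriedliVelenik2017, §7.2.6 (labels)] -/
def IsMinusComp (σ : SpinConfig (Site d)) (A : Finset (Site d)) : Prop := ∀ y ∈ inBoundary A, bsign b r σ y = -1

/-- On a contour, a component which is not a `-` component has all interior-boundary signs `+1`.
[cite: FriedliVelenik2017, §7.2.6 (labels)] -/
theorem bsign_eq_one_of_not_isMinusComp (hd : 2 ≤ d) (hb : 2 ≤ b) (hr : 2 ≤ r) {σ : SpinConfig (Site d)} {S A : Finset (Site d)}
    (hS : StarConn (S : Set (Site d))) (hcont : IsContour b r σ S) (hA : A ∈ Comps S) (hnm : ¬ IsMinusComp b r σ A)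
    {y : Site d} (hy : y ∈ inBoundary A) : bsign b r σ y = 1 := by
  unfold IsMinusComp at hnm
  push Not at hnm
  obtain ⟨y', hy', hne⟩ := hnm
  rw [bsign_eq_of_mem_inBoundary hd hb hr hS hcont hA hy hy']
  rcases bsign_eq_or (b := b) (r := r) σ y' with h | h
  · exact h
  · exact absurd h hne

/-- **The rim lemma**: in a component, a site within sup-distance `r` of a point outside the
component lies in the `r`-ball of an interior-boundary site.
[cite: FriedliVelenik2017, §7.2.6 (the configuration is constant near the boundary of a component)] -/
theorem exists_inBoundary_of_supDist_le {S A : Finset (Site d)} (hA : A ∈ Comps S) {u y : Site d}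
    (hu : u ∈ A) (hy : y ∉ A) (huy : supDist u y ≤ r) : ∃ v ∈ inBoundary A, u ∈ supBall r v := by
  have _ := hA
  obtain ⟨v, v', hv, hv', hadj, hvbox, -⟩ := exists_adj_exit (A : Set (Site d)) (mem_coe.2 hu) (fun h => hy (mem_coe.1 h))
  refine ⟨v, mem_inBoundary.2 ⟨mem_coe.1 hv, v', fun h => hv' (mem_coe.2 h), zdGraph_le_zdStar hadj⟩, ?_⟩
  rw [mem_supBall, supDist_comm]
  exact (supDist_le_of_mem_cbox hvbox).1.trans huy

/-- **The rim lemma, spin form**: on a contour, in a `-` component, a spin site within sup-distance `r`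
of the outside of the component carries `-1`. [cite: FriedliVelenik2017, §7.2.6] -/
theorem apply_eq_neg_one_of_supDist_le (hd : 2 ≤ d) {σ : SpinConfig (Site d)} {S A : Finset (Site d)}
    (hcont : IsContour b r σ S) (hA : A ∈ Comps S) (hm : IsMinusComp b r σ A) {u y : Site d}
    (hu : u ∈ A) (hus : IsSpin b u) (hy : y ∉ A) (huy : supDist u y ≤ r) : σ u = -1 := by
  obtain ⟨v, hv, huv⟩ := exists_inBoundary_of_supDist_le hA hu hy huy
  rw [apply_eq_bsign (hcont.2 v (mem_exBoundary_of_mem_inBoundary hd hA hv)) huv hus, hm v hv]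

/-- **Forward ray exit**: from a point of a finite set, the ray in direction `+eⱼ` leaves the set:
`u + t eⱼ ∈ A`, `u + (t+1) eⱼ ∉ A` for some `t`. [folklore] -/
theorem exists_ray_exit_add (A : Finset (Site d)) {u : Site d} (hu : u ∈ A) (j : Fin d) :
    ∃ t : ℕ, u + (t : ℤ) • uvec j ∈ A ∧ u + ((t : ℤ) + 1) • uvec j ∉ A := by
  classical
  obtain ⟨m, hm, hmax⟩ := exists_max_image A (fun x : Site d => x j) ⟨u, hu⟩
  have hex : ∃ t : ℕ, u + ((t : ℤ) + 1) • uvec j ∉ A := by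
    refine ⟨(m j - u j).toNat, fun h => ?_⟩
    have := hmax _ h
    simp only [Pi.add_apply, Pi.smul_apply, Pi.single_eq_same, smul_eq_mul, mul_one] at this
    omega
  refine ⟨Nat.find hex, ?_, Nat.find_spec hex⟩
  rcases Nat.eq_zero_or_pos (Nat.find hex) with h0 | hpos
  · rw [h0]; simpa using hu
  · have := Nat.find_min hex (m := Nat.find hex - 1) (by omega)
    rw [not_not] at this
    have hcast : (((Nat.find hex - 1 : ℕ) : ℤ) + 1) = (Nat.find hex : ℤ) := by
      rw [Nat.cast_sub (by omega : 1 ≤ Nat.find hex)]; push_cast; ring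
    rwa [hcast] at this

/-- **Backward ray exit**: `u - t eⱼ ∈ A`, `u - (t+1) eⱼ ∉ A` for some `t`. [folklore] -/
theorem exists_ray_exit_sub (A : Finset (Site d)) {u : Site d} (hu : u ∈ A) (j : Fin d) :
    ∃ t : ℕ, u - (t : ℤ) • uvec j ∈ A ∧ u - ((t : ℤ) + 1) • uvec j ∉ A := by
  classical
  obtain ⟨m, hm, hmin⟩ := exists_min_image A (fun x : Site d => x j) ⟨u, hu⟩
  have hex : ∃ t : ℕ, u - ((t : ℤ) + 1) • uvec j ∉ A := by
    refine ⟨(u j - m j).toNat, fun h => ?_⟩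
    have := hmin _ h
    simp only [Pi.sub_apply, Pi.smul_apply, Pi.single_eq_same, smul_eq_mul, mul_one] at this
    omega
  refine ⟨Nat.find hex, ?_, Nat.find_spec hex⟩
  rcases Nat.eq_zero_or_pos (Nat.find hex) with h0 | hpos
  · rw [h0]; simpa using hu
  · have := Nat.find_min hex (m := Nat.find hex - 1) (by omega)
    rw [not_not] at this
    have hcast : (((Nat.find hex - 1 : ℕ) : ℤ) + 1) = (Nat.find hex : ℤ) := by
      rw [Nat.cast_sub (by omega : 1 ≤ Nat.find hex)]; push_cast; ring
    rwa [hcast] at this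

/-- A good site of sign `-1` is at distance `> r` from every spin site carrying `+1`, in particular
`|v i| + r ≤ b R'` coordinatewise (the spin sites `v ± r eᵢ`, or their neighbours, carry `-1` and lie in
`Λ_{R'}`). [cite: VanenterFernandezSokal1993, §4.3.1 Step 2] -/
theorem natAbs_add_le_of_bsign_eq_neg_one (hd : 2 ≤ d) (hb : 2 ≤ b) (hr : 1 ≤ r) {σ : SpinConfig (Site d)} (hσ : IsCfg b p R' σ)
    {v : Site d} (hv : ¬ IsBad b r σ v) (hsv : bsign b r σ v = -1) (i : Fin d) : ((v i).natAbs : ℤ) + r ≤ b * R' := by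
  obtain ⟨k, hki⟩ : ∃ k : Fin d, k ≠ i := by
    by_cases hi0 : i = ⟨0, by omega⟩
    · exact ⟨⟨1, by omega⟩, fun h => by rw [hi0] at h; exact absurd (congrArg Fin.val h) (by simp)⟩
    · exact ⟨⟨0, by omega⟩, fun h => hi0 h.symm⟩
  have key : ∀ s : ℤ, (s = 1 ∨ s = -1) → s * v i + r ≤ b * R' := by
    intro s hs
    set w : Site d := v + (s * r) • uvec i with hw
    have hwc : ∀ m, w m = v m + if m = i then s * r else 0 := fun m => by rw [hw, add_zsmul_single_apply]
    obtain ⟨z, hzs, hzc⟩ : ∃ z : Site d, IsSpin b z ∧ ∀ m, z m = w m ∨ (m = k ∧ z m = w m + 1) := by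
      by_cases hws : IsSpin b w
      · exact ⟨w, hws, fun m => Or.inl rfl⟩
      · have hwimg : IsSpImageSite d b w := by rw [isSpin_iff_not_isGImg, not_not] at hws; exact hws.1
        refine ⟨w + uvec k, isSpin_of_adj_isSpImageSite hb hwimg (zdGraph_adj_add_uvec w k), fun m => ?_⟩
        rw [Pi.add_apply, uvec_apply]
        by_cases hmk : m = k
        · exact Or.inr ⟨hmk, by rw [if_pos hmk]⟩
        · exact Or.inl (by rw [if_neg hmk, add_zero])
    have hzB : z ∈ supBall r v := mem_supBall_iff_forall.2 fun m => by
      rcases hzc m with h | ⟨hmk, h⟩ <;> rw [h, hwc]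
      · by_cases hmi : m = i
        · rw [if_pos hmi]; rcases hs with h' | h' <;> rw [h'] <;> omega
        · rw [if_neg hmi]; omega
      · rw [if_neg (hmk ▸ hki)]; omega
    have hz1 : σ z = -1 := by rw [apply_eq_bsign hv hzB hzs, hsv]
    have hzbox := (mem_box.1 (mem_box_of_mem_spacingVolume (hσ.mem_of_apply_eq_neg_one hzs hz1))) i
    have hzi : z i = v i + s * r := by
      rcases hzc i with h | ⟨hik, _⟩
      · rw [h, hwc, if_pos rfl]
      · exact absurd hik.symm hki
    rcases hs with rfl | rfl <;> push_cast at hzbox hzi ⊢ <;> omega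
  have k1 := key 1 (Or.inl rfl)
  have k2 := key (-1) (Or.inr rfl)
  omega

/-- **`-` components stay `r` inside the box**: for a configuration of the system, every point `u` of a
`-` component of a contour satisfies `|u i| + r ≤ b R'` for all coordinates (apply the previous lemma
to the ray exits of `u` in the directions `± eᵢ`, which are interior-boundary sites of sign `-1`).
[cite: VanenterFernandezSokal1993, §4.3.1 Step 2; FriedliVelenik2017, §7.2.6] -/
theorem natAbs_add_le_of_mem_minusComp (hd : 2 ≤ d) (hb : 2 ≤ b) (hr : 1 ≤ r) {σ : SpinConfig (Site d)} (hσ : IsCfg b p R' σ)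
    {S A : Finset (Site d)} (hcont : IsContour b r σ S) (hA : A ∈ Comps S) (hm : IsMinusComp b r σ A)
    {u : Site d} (hu : u ∈ A) (i : Fin d) : ((u i).natAbs : ℤ) + r ≤ b * R' := by
  obtain ⟨t, ht, ht'⟩ := exists_ray_exit_add A hu i
  obtain ⟨t', hst, hst'⟩ := exists_ray_exit_sub A hu i
  have hadj1 : (zdStar d).Adj (u + (t : ℤ) • uvec i) (u + ((t : ℤ) + 1) • uvec i) := by
    have : u + ((t : ℤ) + 1) • uvec i = u + (t : ℤ) • uvec i + (1 : ℤ) • (Pi.single i (1 : ℤ) : Site d) := by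
      rw [add_smul, add_assoc]
    rw [this]; exact zdGraph_le_zdStar (zdGraph_adj_add_zsmul_single _ i (Or.inl rfl))
  have hadj2 : (zdStar d).Adj (u - (t' : ℤ) • uvec i) (u - ((t' : ℤ) + 1) • uvec i) := by
    have : u - ((t' : ℤ) + 1) • uvec i = u - (t' : ℤ) • uvec i + (-1 : ℤ) • (Pi.single i (1 : ℤ) : Site d) := by
      rw [add_smul, one_smul, neg_one_smul, sub_add_eq_sub_sub, sub_eq_add_neg]
    rw [this]; exact zdGraph_le_zdStar (zdGraph_adj_add_zsmul_single _ i (Or.inr rfl))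
  have hv1 : u + (t : ℤ) • uvec i ∈ inBoundary A := mem_inBoundary.2 ⟨ht, _, ht', hadj1⟩
  have hv2 : u - (t' : ℤ) • uvec i ∈ inBoundary A := mem_inBoundary.2 ⟨hst, _, hst', hadj2⟩
  have k1 := natAbs_add_le_of_bsign_eq_neg_one hd hb hr hσ (hcont.2 _ (mem_exBoundary_of_mem_inBoundary hd hA hv1)) (hm _ hv1) i
  have k2 := natAbs_add_le_of_bsign_eq_neg_one hd hb hr hσ (hcont.2 _ (mem_exBoundary_of_mem_inBoundary hd hA hv2)) (hm _ hv2) i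
  simp only [Pi.add_apply, Pi.sub_apply, Pi.smul_apply, Pi.single_eq_same, smul_eq_mul, mul_one] at k1 k2
  omega

/-- Hence the spin sites of a `-` component lie in `W(R')`. [cite: VanenterFernandezSokal1993, §4.3.1 Step 2] -/
theorem mem_spacingVolume_of_mem_minusComp (hd : 2 ≤ d) (hb : 2 ≤ b) (hr : 1 ≤ r) {σ : SpinConfig (Site d)}
    (hσ : IsCfg b p R' σ) {S A : Finset (Site d)} (hcont : IsContour b r σ S) (hA : A ∈ Comps S) (hm : IsMinusComp b r σ A)
    {u : Site d} (hu : u ∈ A) (hus : IsSpin b u) : u ∈ spacingVolume d b R' := by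
  refine mem_spacingVolume_of_isSpin hus (mem_box.2 fun i => ?_)
  have := natAbs_add_le_of_mem_minusComp hd hb hr hσ hcont hA hm hu i
  omega

/-- Points of a `-` component lie in `box (b R' - r)`, stated without truncated subtraction.
[cite: VanenterFernandezSokal1993, §4.3.1 Step 2] -/
theorem abs_le_of_mem_minusComp (hd : 2 ≤ d) (hb : 2 ≤ b) (hr : 1 ≤ r) {σ : SpinConfig (Site d)}
    (hσ : IsCfg b p R' σ) {S A : Finset (Site d)} (hcont : IsContour b r σ S) (hA : A ∈ Comps S) (hm : IsMinusComp b r σ A)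
    {u : Site d} (hu : u ∈ A) (i : Fin d) : -((b : ℤ) * R' - r) ≤ u i ∧ u i ≤ (b : ℤ) * R' - r := by
  have := natAbs_add_le_of_mem_minusComp hd hb hr hσ hcont hA hm hu i
  omega

end Interior

end SpacingPeierls

end Literature.Barriers.CriticalPhenomena.NonGibbs

end
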